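import Summits.ABC.IUTFork.Conditional.WRowUnconditionalPackages
import Summits.ABC.IUTFork.Conditional.WRowUnconditionalCellsBase
import Summits.ABC.IUTFork.Cor312GenuineKTwistLowerBoundUnconditional
import HarnessLib

/-!
# The hull licence at the `K`-level datum of ANY abc triple — INTEGER-SLOT SOCKET WITH A LOCAL-TYPE HOOK: the arithmetic `hcell` may use
# any fibre-point property `Q p e` of the local type that the caller proves at the datum (exact types, a pinned candidate, a class)

PROOF-ONLY file (D-0012; 0 definitions, 0 `Prop` facts) of the abc-iut cell — D-0079 RESCUE sub-cell R-W «WINDOW Θ-SIDE INEQUALITY», W1 ROW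
DECISIONS composer seat abc-iut-W-row-1 (gen 4), row «W:FREY73-RESIDUAL» (abc-iut-plan rulings C-R82 (a)(ii) / C-R83 (a),(b): TYPE-SPLIT rows).
It is this seat's «W:UNCONDITIONAL-TRIPLE-SOCKET», integer-slot variant (`Cor312LicenceTripleUnconditionalSlot`, p488934; SAME proof, same one-sided
local inputs), with ONE extra hypothesis pair: a predicate `Q : ℕ → ℕ → Prop` on (prime, local type) and its discharge `hQ` at the datum — «every BAD
fibre point `x | p` of `pilotDataOfK T.D T.K` has `Q p (e(K_x/ℚ_p))`» — in exchange for which the arithmetic hypothesis `hcell` receives `Q p e` as an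
additional antecedent. With `Q := fun _ _ => True` it is p488934 verbatim; with `Q p e := (p = p₀ → e = e₀)` it is the INHABITED HALF of a TYPE-SPLIT
row (C-R83 (b) shape (B): «Licence ∀ T when `e(·|p₀) = e₀`»), the cells at `p₀` being checked at the single type `e₀` and everywhere else over the
tree's lower-bound classes as before; with `Q p e := (e = f p)` for an exact local-type FUNCTION `f` (abc-iut-W-neg-1's `…_eq_wild_ite_ratPoint`,
abc-iut-W-neg-2's exact tame types) it is the exact-type licence. Nothing else changes: abc-iut-W-row-1's orders socket
`Cor312Prov.licence_settingPrVolSharp_pilotDataOfK_of_orders_rat` (abc-iut-w4-d036's exact cell p460046/p460573), abc-iut-W-row-2's abc-triple tools,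
abc-iut-W-ref-2's `Cor22.ord_jInv_ratPoint_triple_eq`, abc-iut-W-neg-1 / W-neg-2 / w4-d107's lower bounds on the ramification index and the wild
different, abc-iut-c312-5's integer-slot inner witness and abc-iut-w4-d094 / c312-3's envelope members (`WRowUnconditionalPackages` §1). TAKES NO SIDE
on [IUTchIII] Cor. 3.12 (S. Mochizuki, *Inter-universal Teichmüller theory III*, Cor. 3.12 p. 173–174; Step (xi-f) p. 184) or on any author;
«inhabited as typed» ≠ «asserted in print».

WHAT IS PROVED (namespace `Summit.ABC.IUTFork.Conditional`):
* **`WRow.licence_triple_slot_of_localType`** — for an abc triple `(a, b, c)`, ANY level `l`, EVERY genuine Θ-volume datum `T` at `(ratPoint (a/c), l)`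
  with `hQ : ∀ bad x | p, Q p (e(K_x/ℚ_p))`, and EVERY pair of realising Θ- and q-ideles: abc-iut-c312-1's `Thm311ToCor312.Licence` HOLDS at
  `settingPrVolSharp (pilotDataOfK T.D T.K) …` PROVIDED the purely arithmetic hypothesis `hcell`: for every prime `p ∣ abc`, `p ∉ {2, l}`, and EVERY
  `e ≥ 1` with `l ∣ e`, `15·l ∣ e·v_p(abc)`, (`p ∣ 30 ⇒ (p−1) ∣ e`), (`p ∣ c`, `v_p(c)` odd ⇒ `30·l ∣ e·v_p(abc)`) AND `Q p e`: `e` is off the cyclotomic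
  indices `p^k(p−1)` and the integer cells `e·⌊(j²P − j·D − (j+1)·ρin)/e⌋ + (j+1)·ρout ≤ P` hold at every label `j ≤ (l−1)/2` (`P = e·v_p(abc)/l`,
  `D = 2e − 1` at `p ∈ {3, 5}` with `p ∤ v_p(abc)`, else `e − 1`; `ρin = max(1, ⌊e/(p−1)⌋)`; `ρout = min(p^{A p} − A p·e, p^{B p} − B p·e)`).
* **`WRow.exists_qPinned_and_hull_triple_slot_of_localType`** — the branch-C corollary «∃ ρ qK, QPinned ∧ PilotKummerCompatHull» (any columns).
First consumer: `Conditional/WRowFrey73NineteenInhabitedHalf` (`73 + 2¹³7⁷941² = 3¹⁶103³127`, `l = 19`, `Q p e := (p = 7 → e = 570)`).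
READING (neutral): a sufficient condition for the per-datum S_H object of the window certificates (`hSHwBad`, p453137 / p450130) to be INHABITED
at the sub-class of `(ratPoint (a/c), l)` cut out by `Q`; admissibility / (P6) and NON-EMPTINESS of that sub-class are NOT claimed. HONEST SCOPE: OUR
sharp containers; STRONGER-THAN-PRINT hull reading; nothing about the printed inequality or any author's intended hull; typed ≠ proved; instantiated ≠
endorsed; no abc claim.
[cite: Mochizuki2012, IUTchI Def. 3.1 (b),(c) pp. 61–62, Rmk. 3.1.5 p. 65, Ex. 3.2 (iv) p. 71; IUTchIII Cor. 3.12 Step (xi-f) p. 184; IUTchIV Prop. 1.1 p. 9, Prop. 1.2 (i)(ii) p. 10, Prop. 1.4 (ii) p. 13, Cor. 2.2 (ii) proof (P5) p. 46]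
[cite: DupuyHilado2025, §3.3, §3.4, §4.9, §4.12] [cite: NeukirchANT1999, Ch. II (5.5)–(5.7)] [cite: CasselsFrohlichANT1967, Ch. VII Prop. 1.2 (ii)]
[cite: SilvermanAEC2009, Prop. III.1.7(b)] [cite: SilvermanATAEC1994, V.5 Thm. 5.3 and Cor. 5.4] [claim: Mochizuki2012, status: disputed] for every IUT sentence.
-/


noncomputable section

open Set Function Metric NumberField IsDedekindDomain

namespace Summit.ABC.IUTFork.Conditional

open Thm311 Thm311.Real Cor312 Cor312Vol Cor312Prov Literature.IUT.LogThetaLattice Literature.IUT.LogVolume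
  Literature.IUT.HodgeTheaters Literature.IUT.LogVolume.Cor22
open Literature.NumberTheory.NumberFields Literature.NumberTheory.GaloisRepresentations.Ultrametric
open Literature.NumberTheory.DiophantineGeometry Literature.NumberTheory.DiophantineGeometry.GenEll

/-! ## The licence at the `K`-level datum of an abc triple from the arithmetic condition, with a local-type hook `Q` -/

/-- **THE HULL LICENCE AT THE `K`-LEVEL DATUM OF AN abc TRIPLE, WITH A LOCAL-TYPE HOOK.** `a + b = c` an abc triple, `l` any level,
`T` ANY genuine Θ-volume datum at `(ratPoint (a/c), l)` ([IUTchIV] Cor. 2.2 (ii) proof (P7)) at which every BAD fibre point `x | p` satisfies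
`Q p (e(K_x/ℚ_p))` (`hQ`), Θ- and q-ideles REALISING the pilot divisors of `X := pilotDataOfK T.D T.K`; `j(a/c) ≠ 1728`; exponents `A, B : ℕ → ℕ`.
IF (`hcell`) for every prime `p ∣ abc` with `p ≠ 2`, `p ≠ l` and EVERY `e ≥ 1` with `l ∣ e`, `15·l ∣ e·v_p(abc)`, (`p ∣ 30 ⇒ (p−1) ∣ e`),
(`p ∣ c ∧ v_p(c)` odd ⇒ `30·l ∣ e·v_p(abc)`) and `Q p e`: `e ≠ p^k(p−1)` for all `k`, and at every label `j = i + 1 ≤ (l−1)/2` the integer cell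
`e·⌊(j²P − j·D − (j+1)·ρin)/e⌋ + (j+1)·min(p^{A p} − A p·e, p^{B p} − B p·e) ≤ P`, `P = e·2v_p(abc)/(2l)`, `D = 2e−1` if `p ∣ 30 ∧ p ∤ v_p(abc)` else
`e − 1`, `ρin = max(1, ⌊e/(p−1)⌋)` — THEN abc-iut-c312-1's `Thm311ToCor312.Licence` HOLDS at abc-iut-c312-7's `settingPrVolSharp X …`.
WHY the arithmetic suffices: a bad `x | p` has `p ∣ abc`, `p ≠ 2, l` and `ord_p j(a/c) = −2v_p(abc)`; `d_mod = 1` makes the bad completions over `p`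
isometrically conjugate, so `e(K_x/ℚ_p)` is ONE number `e` per prime, and `l ∣ e`, `15l ∣ e·v_p`, `(p−1) ∣ e` (`p ∣ 30`), `30l ∣ e·v_p`
(`p ∣ c`, `v_p` odd) are theorems (abc-iut-W-neg-1 / W-neg-2 / w4-d107) and `Q p e` is the caller's `hQ`; the socket's one-sided inputs `D` (W-neg-1's Eisenstein-radical different at `3, 5`; `(e−1)/e` always), `ρin`
(abc-iut-c312-5's integer slot at every odd `p`, else the volume witness `1`) and `ρout` (two envelope members, `e` off the cyclotomic indices) hold for THAT `e`.
[cite: Mochizuki2012, IUTchI Def. 3.1 (b),(c) pp. 61–62, Rmk. 3.1.5 p. 65, Ex. 3.2 (iv) p. 71; IUTchIII Cor. 3.12 Step (xi-f) p. 184; IUTchIV Prop. 1.1 p. 9, Prop. 1.2 (i)(ii) p. 10, Prop. 1.4 (ii) p. 13, Cor. 2.2 (ii) proof (P5) p. 46] [cite: DupuyHilado2025, §3.3, §3.4, §4.9, §4.12]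
[cite: SilvermanAEC2009, Prop. III.1.7(b)] [claim: Mochizuki2012, status: disputed] -/
theorem WRow.licence_triple_slot_of_localType {a b c l : ℕ} (habc : IsABCTriple a b c)
    (hj1728 : Cor22.jInv ((a : ℚ) / c) ≠ 1728) (T : Cor22.ThetaVolumeDatumAt (ratPoint ((a : ℚ) / c)) l) (A B : ℕ → ℕ)
    (Q : ℕ → ℕ → Prop)
    (hQ : letI := T.instFieldF; letI := T.instNumberFieldF; letI := T.instAlgebraF; letI := T.instFieldK
      letI := T.instNumberFieldK; letI := T.instAlgebraK; letI := T.instFieldFbar; letI := T.instAlgebraFbar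
      letI := T.instAlgebraKFbar; letI := T.instIsElliptic
      ∀ (pp : Nat.Primes) (x : (thetaIndex (pilotDataOfK T.D T.K)).Fibre (.inr pp)),
        haveI : Fact (pp : ℕ).Prime := ⟨pp.2⟩
        placeOf (pilotDataOfK T.D T.K) pp.1 x ∈ (pilotDataOfK T.D T.K).S →
          Q pp (absRamificationIdx (pp : ℕ) (kOf (pilotDataOfK T.D T.K) pp.1 x)))
    (hcell : ∀ p : ℕ, p.Prime → p ∣ a * b * c → p ≠ 2 → p ≠ l → ∀ e : ℕ, 0 < e → l ∣ e →
      15 * l ∣ e * (a * b * c).factorization p → (p ∣ 30 → (p - 1) ∣ e) →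
      (p ∣ c → Odd ((a * b * c).factorization p) → 30 * l ∣ e * (a * b * c).factorization p) → Q p e →
      (∀ k : ℕ, (e : ℤ) ≠ (p : ℤ) ^ k * ((p : ℤ) - 1)) ∧
      ∀ i : ℕ, i < (l - 1) / 2 →
        (e : ℤ) * ((((i + 1 : ℕ) : ℤ) ^ 2 * ((e * (2 * (a * b * c).factorization p) / (2 * l) : ℕ) : ℤ) -
            ((i + 1 : ℕ) : ℤ) * (((if p ∣ 30 ∧ ¬ p ∣ (a * b * c).factorization p then 2 * e - 1 else e - 1 : ℕ) : ℕ) : ℤ) -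
            ((i + 2 : ℕ) : ℤ) * ((((max 1 (e / (p - 1))) : ℕ) : ℤ))) / (e : ℤ)) +
          ((i + 2 : ℕ) : ℤ) * min ((p : ℤ) ^ A p - (A p : ℤ) * (e : ℤ)) ((p : ℤ) ^ B p - (B p : ℤ) * (e : ℤ)) ≤
        ((e * (2 * (a * b * c).factorization p) / (2 * l) : ℕ) : ℤ))
    :
    letI := T.instFieldF; letI := T.instNumberFieldF; letI := T.instAlgebraF; letI := T.instFieldK
    letI := T.instNumberFieldK; letI := T.instAlgebraK; letI := T.instFieldFbar; letI := T.instAlgebraFbar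
    letI := T.instAlgebraKFbar; letI := T.instIsElliptic
    ∀ {logv : PadicLogs T.K} (hlog : LogvAnalytic logv) (M : Type) [Field M] [NumberField M]
      (archPk : ∀ (j : (thetaIndex (pilotDataOfK T.D T.K)).Label) (vQ : (thetaIndex (pilotDataOfK T.D T.K)).VQ),
        Set ((logShellsDH (pilotDataOfK T.D T.K) logv).Packet j vQ))
      (archSub : ∀ (j : (thetaIndex (pilotDataOfK T.D T.K)).Label) (v : (thetaIndex (pilotDataOfK T.D T.K)).V),
        Set ((logShellsDH (pilotDataOfK T.D T.K) logv).Packet j ((thetaIndex (pilotDataOfK T.D T.K)).over v)))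
      (Ψ : ℤ → ∀ v : (thetaIndex (pilotDataOfK T.D T.K)).V, v ∈ (thetaIndex (pilotDataOfK T.D T.K)).Vbad →
        Set ((logShellsDH (pilotDataOfK T.D T.K) logv).StarPacket v))
      (act : ℤ → ∀ v : (thetaIndex (pilotDataOfK T.D T.K)).V, v ∈ (thetaIndex (pilotDataOfK T.D T.K)).Vbad →
        (logShellsDH (pilotDataOfK T.D T.K) logv).StarPacket v → Module.End ℚ ((logShellsDH (pilotDataOfK T.D T.K) logv).StarPacket v))
      (Mmod : ℤ → ∀ j : (thetaIndex (pilotDataOfK T.D T.K)).LabelStar, Set ((logShellsDH (pilotDataOfK T.D T.K) logv).GlobalPacket j.1))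
      (region : ℤ → ∀ j : (thetaIndex (pilotDataOfK T.D T.K)).LabelStar, FinDivisor M → ∀ vQ : (thetaIndex (pilotDataOfK T.D T.K)).VQ,
        Set ((logShellsDH (pilotDataOfK T.D T.K) logv).Packet j.1 vQ))
      (n : ℤ) {HT : Type} {LogLink : HT → HT → Type} {IsFull : ∀ {s t : HT}, LogLink s t → Prop}
      (lat : LGPGaussianLogThetaLattice LogLink IsFull)
      {Frd : Type} {IsoF : Frd → Frd → Type} {Ob : Frd → Type} {realify : Frd → Frd} {Strip : Type}
      {IsoS : Strip → Strip → Type} {Mv : ∀ v : (thetaIndex (pilotDataOfK T.D T.K)).V, v ∈ (thetaIndex (pilotDataOfK T.D T.K)).Vbad → Type}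
      [∀ v h, Monoid (Mv v h)]
      (sig : GlobalLGPFrobenioidSignature (thetaIndex (pilotDataOfK T.D T.K)).lstar (thetaIndex (pilotDataOfK T.D T.K)).V
        (· ∈ (thetaIndex (pilotDataOfK T.D T.K)).Vbad) Frd IsoF Ob realify Strip IsoS Mv)
      (split : SplittingMonoids Mv) {ObΔ : Type} {N : ∀ v : (thetaIndex (pilotDataOfK T.D T.K)).V, v ∈ (thetaIndex (pilotDataOfK T.D T.K)).Vbad → Type}
      [∀ v h, Monoid (N v h)] (qData : QPilotData ObΔ N)
      (tq : ∀ (pp : Nat.Primes) (x : (thetaIndex (pilotDataOfK T.D T.K)).Fibre (.inr pp)),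
        haveI : Fact (pp : ℕ).Prime := ⟨pp.2⟩; kOf (pilotDataOfK T.D T.K) pp.1 x)
      (t : ∀ (pp : Nat.Primes) (_ : Fin (pilotDataOfK T.D T.K).lstar) (x : (thetaIndex (pilotDataOfK T.D T.K)).Fibre (.inr pp)),
        haveI : Fact (pp : ℕ).Prime := ⟨pp.2⟩; kOf (pilotDataOfK T.D T.K) pp.1 x)
      (htq0 : ∀ pp x, tq pp x ≠ 0)
      (htq1 : ∀ (pp : Nat.Primes) (x : (thetaIndex (pilotDataOfK T.D T.K)).Fibre (.inr pp)),
        haveI : Fact (pp : ℕ).Prime := ⟨pp.2⟩; placeOf (pilotDataOfK T.D T.K) pp.1 x ∉ (pilotDataOfK T.D T.K).S → ‖tq pp x‖ = 1)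
      (_ht0 : ∀ pp i x, t pp i x ≠ 0)
      (_ht : ∀ (pp : Nat.Primes) (i : Fin (pilotDataOfK T.D T.K).lstar) (x : (thetaIndex (pilotDataOfK T.D T.K)).Fibre (.inr pp)),
        haveI : Fact (pp : ℕ).Prime := ⟨pp.2⟩
        Real.log ‖t pp i x‖ = -((pilotDataOfK T.D T.K).thetaPilot i (placeOf (pilotDataOfK T.D T.K) pp.1 x)) *
          logNorm T.K (placeOf (pilotDataOfK T.D T.K) pp.1 x) / localDegree T.K (placeOf (pilotDataOfK T.D T.K) pp.1 x))
      (_htq : ∀ (pp : Nat.Primes) (x : (thetaIndex (pilotDataOfK T.D T.K)).Fibre (.inr pp)),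
        haveI : Fact (pp : ℕ).Prime := ⟨pp.2⟩
        Real.log ‖tq pp x‖ = -((pilotDataOfK T.D T.K).qPilot (placeOf (pilotDataOfK T.D T.K) pp.1 x)) *
          logNorm T.K (placeOf (pilotDataOfK T.D T.K) pp.1 x) / localDegree T.K (placeOf (pilotDataOfK T.D T.K) pp.1 x)),
      Thm311ToCor312.Licence
        (settingPrVolSharp (pilotDataOfK T.D T.K) hlog M archPk archSub Ψ act Mmod region n lat sig split qData tq t htq0 htq1) := by
  classical
  letI := T.instFieldF; letI := T.instNumberFieldF; letI := T.instAlgebraF; letI := T.instFieldK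
  letI := T.instNumberFieldK; letI := T.instAlgebraK; letI := T.instFieldFbar; letI := T.instAlgebraFbar
  letI := T.instAlgebraKFbar; letI := T.instIsElliptic
  intro logv hlog M _ _ archPk archSub Ψ act Mmod region n HT LogLink IsFull lat Frd IsoF Ob realify Strip
    IsoS Mv _ sig split ObΔ N _ qData tq t htq0 htq1 ht0 ht htq
  have hjF : T.E.j = ((jInv ((a : ℚ) / c) : ℚ) : T.F) := by rw [T.j_eq]; exact eq_ratCast _ _
  have hlstar : (pilotDataOfK T.D T.K).lstar = (l - 1) / 2 := by
    show ((pilotDataOfK T.D T.K).l - 1) / 2 = (l - 1) / 2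
    rw [pilotDataOfK_l]
  have ha : 0 < a := habc.1
  have hb : 0 < b := habc.2.1
  have hc : 0 < c := by have := habc.2.2.1; omega
  have habc0 : a * b * c ≠ 0 := by positivity
  -- at a prime `p ∣ c`: `p ∤ ab`, `v_p(abc) = v_p(c)` and `ord_p(a/c) = −v_p(c)`
  have hordq : ∀ pp : Nat.Primes, (pp : ℕ) ∣ c → ∀ v : HeightOneSpectrum (𝓞 ℚ), Rat.HeightOneSpectrum.natGenerator v = pp →
      ord ℚ v ((a : ℚ) / c) = -(((a * b * c).factorization pp : ℕ) : ℤ) := by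
    intro pp hpc v hv
    haveI : Fact (pp : ℕ).Prime := ⟨pp.2⟩
    have hac : Nat.Coprime a c := by rw [← habc.2.2.1]; exact Nat.coprime_self_add_right.mpr habc.2.2.2
    have hbc : Nat.Coprime b c := by rw [← habc.2.2.1]; exact Nat.coprime_add_self_right.mpr habc.2.2.2.symm
    have hpa : ¬ (pp : ℕ) ∣ a := fun hpa => by
      have h1 : (pp : ℕ) ∣ 1 := by have h := Nat.dvd_gcd hpa hpc; rwa [Nat.Coprime.gcd_eq_one hac] at h
      exact pp.2.one_lt.ne' (Nat.eq_one_of_dvd_one h1)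
    have hpb : ¬ (pp : ℕ) ∣ b := fun hpb => by
      have h1 : (pp : ℕ) ∣ 1 := by have h := Nat.dvd_gcd hpb hpc; rwa [Nat.Coprime.gcd_eq_one hbc] at h
      exact pp.2.one_lt.ne' (Nat.eq_one_of_dvd_one h1)
    have hfac : (a * b * c).factorization pp = c.factorization pp := by
      rw [Nat.factorization_mul (Nat.mul_ne_zero ha.ne' hb.ne') hc.ne', Nat.factorization_mul ha.ne' hb.ne', Finsupp.add_apply,
        Finsupp.add_apply, Nat.factorization_eq_zero_of_not_dvd hpa, Nat.factorization_eq_zero_of_not_dvd hpb, zero_add, zero_add]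
    have hq0 : ((a : ℚ) / c) ≠ 0 := div_ne_zero (by exact_mod_cast ha.ne') (by exact_mod_cast hc.ne')
    rw [GenuineK.ord_rat_eq_padicValRat v hq0, hv, padicValRat.div (by exact_mod_cast ha.ne') (by exact_mod_cast hc.ne'),
      padicValRat.of_nat, padicValRat.of_nat, padicValNat.eq_zero_of_not_dvd hpa, hfac, Nat.factorization_def c pp.2]
    simp
  -- `d_mod = 1`: conjugate, isometric bad fibres
  have hFm : Module.finrank ℚ (fieldOfModuli T.E) = 1 := by
    rw [T.finrank_rat_fieldOfModuli_eq_dmod]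
    exact dmod_eq_one_of_degree_le_one (by rw [degree_ratPoint])
  -- the per-prime data (e, D, h, ρin, ρout): `e` is the ACTUAL (unknown) index at some bad fibre point
  set eF : Nat.Primes → ℕ := fun pp =>
    haveI : Fact (pp : ℕ).Prime := ⟨pp.2⟩
    if h : ∃ x : (thetaIndex (pilotDataOfK T.D T.K)).Fibre (.inr pp), placeOf (pilotDataOfK T.D T.K) pp.1 x ∈ (pilotDataOfK T.D T.K).S
    then absRamificationIdx (pp : ℕ) (kOf (pilotDataOfK T.D T.K) pp.1 h.choose) else 1 with heF
  set DF : Nat.Primes → ℕ := fun pp =>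
    if (pp : ℕ) ∣ 30 ∧ ¬ (pp : ℕ) ∣ (a * b * c).factorization pp then 2 * eF pp - 1 else eF pp - 1 with hDF
  set hF : Nat.Primes → ℕ := fun pp => 2 * (a * b * c).factorization pp with hhF
  set rinF : Nat.Primes → ℤ := fun pp => ((((max 1 (eF pp / ((pp : ℕ) - 1))) : ℕ) : ℤ)) with hrinF
  set routF : Nat.Primes → ℤ := fun pp =>
    min (((pp : ℕ) : ℤ) ^ A pp - (A pp : ℤ) * (eF pp : ℤ)) (((pp : ℕ) : ℤ) ^ B pp - (B pp : ℤ) * (eF pp : ℤ)) with hroutF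
  -- at a bad fibre point `x | p`: `e(K_x) = eF p`
  have heq : ∀ (pp : Nat.Primes) (x : (thetaIndex (pilotDataOfK T.D T.K)).Fibre (.inr pp)),
      haveI : Fact (pp : ℕ).Prime := ⟨pp.2⟩
      placeOf (pilotDataOfK T.D T.K) pp.1 x ∈ (pilotDataOfK T.D T.K).S →
        absRamificationIdx (pp : ℕ) (kOf (pilotDataOfK T.D T.K) pp.1 x) = eF pp := by
    intro pp x hx
    haveI : Fact (pp : ℕ).Prime := ⟨pp.2⟩
    have hex : ∃ x : (thetaIndex (pilotDataOfK T.D T.K)).Fibre (.inr pp),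
        placeOf (pilotDataOfK T.D T.K) pp.1 x ∈ (pilotDataOfK T.D T.K).S := ⟨x, hx⟩
    have h1 : eF pp = absRamificationIdx (pp : ℕ) (kOf (pilotDataOfK T.D T.K) pp.1 hex.choose) := by
      simp only [heF, dif_pos hex]
    rw [h1]
    exact WRow.absRamificationIdx_kOf_eq_of_finrank_eq_one T.D hFm pp x hex.choose
  -- everything the tree knows at a bad fibre point `x | p`
  have hfacts : ∀ (pp : Nat.Primes) (x : (thetaIndex (pilotDataOfK T.D T.K)).Fibre (.inr pp)),
      haveI : Fact (pp : ℕ).Prime := ⟨pp.2⟩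
      placeOf (pilotDataOfK T.D T.K) pp.1 x ∈ (pilotDataOfK T.D T.K).S →
        (pp : ℕ) ∣ a * b * c ∧ (pp : ℕ) ≠ 2 ∧ (pp : ℕ) ≠ l ∧ 0 < (a * b * c).factorization pp ∧
        (∀ v : HeightOneSpectrum (𝓞 ℚ), Rat.HeightOneSpectrum.natGenerator v = pp →
          ord ℚ v (jInv ((a : ℚ) / c)) = -(2 * (((a * b * c).factorization pp : ℕ) : ℤ))) ∧
        0 < eF pp ∧ l ∣ eF pp ∧ 15 * l ∣ eF pp * (a * b * c).factorization pp ∧ ((pp : ℕ) ∣ 30 → ((pp : ℕ) - 1) ∣ eF pp) ∧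
        ((pp : ℕ) ∣ c → Odd ((a * b * c).factorization pp) → 30 * l ∣ eF pp * (a * b * c).factorization pp) ∧ Q pp (eF pp) := by
    intro pp x hx
    haveI : Fact (pp : ℕ).Prime := ⟨pp.2⟩
    have hE := heq pp x hx
    have hdvd : (pp : ℕ) ∣ a * b * c := Cor312Prov.natCast_dvd_of_placeOf_mem_S_triple T.D habc hjF pp x hx
    obtain ⟨h2, hl⟩ := ne_two_and_ne_l_of_placeOf_mem_S_pilotDataOfK T.D pp x hx
    have hv : 0 < (a * b * c).factorization pp := Nat.Prime.factorization_pos_of_dvd pp.2 habc0 hdvd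
    have hpole : ∀ v : HeightOneSpectrum (𝓞 ℚ), Rat.HeightOneSpectrum.natGenerator v = pp →
        ord ℚ v (jInv ((a : ℚ) / c)) = -(2 * (((a * b * c).factorization pp : ℕ) : ℤ)) := by
      intro v hv'
      rw [Cor22.ord_jInv_ratPoint_triple_eq habc v (by rw [hv']; exact h2) (by rw [hv']; exact hdvd), hv']
    have hpole' : ∀ v : HeightOneSpectrum (𝓞 ℚ), Rat.HeightOneSpectrum.natGenerator v = pp →
        ord ℚ v (jInv ((a : ℚ) / c)) < 0 := by
      intro v hv'
      rw [hpole v hv']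
      have : (0 : ℤ) < (a * b * c).factorization pp := by exact_mod_cast hv
      linarith
    have hpos := absRamificationIdx_pos (pp : ℕ) (kOf (pilotDataOfK T.D T.K) pp.1 x)
    have hle := GenuineK.prime_dvd_absRamificationIdx_kOf_ratPoint T pp h2 hl hpole' x
    have h15 := GenuineK.fifteen_mul_prime_dvd_absRamificationIdx_kOf_mul_ratPoint T pp h2 hl hv hpole x
    have h30 : (pp : ℕ) ∣ 30 → ((pp : ℕ) - 1) ∣ absRamificationIdx (pp : ℕ) (kOf (pilotDataOfK T.D T.K) pp.1 x) :=
      fun h => GenuineK.sub_one_dvd_absRamificationIdx_kOf T pp h x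
    have hodd : (pp : ℕ) ∣ c → Odd ((a * b * c).factorization pp) →
        30 * l ∣ absRamificationIdx (pp : ℕ) (kOf (pilotDataOfK T.D T.K) pp.1 x) * (a * b * c).factorization pp :=
      fun hpc ho => GenuineK.thirty_mul_prime_dvd_absRamificationIdx_kOf_mul_of_odd_pole T hj1728 pp h2 hl ho (hordq pp hpc) x
    have hq : Q pp (absRamificationIdx (pp : ℕ) (kOf (pilotDataOfK T.D T.K) pp.1 x)) := hQ pp x hx
    rw [hE] at hpos hle h15 h30 hodd hq
    exact ⟨hdvd, h2, hl, hv, hpole, hpos, hle, h15, h30, hodd, hq⟩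
  refine Cor312Prov.licence_settingPrVolSharp_pilotDataOfK_of_orders_rat T.D hlog M archPk archSub Ψ act Mmod region n lat sig split qData
    tq t htq0 htq1 ht0 ht htq (jInv ((a : ℚ) / c)) hjF eF DF hF rinF routF (fun pp x hx => ?_)
    (fun pp x y _ _ => Cor312Prov.nonempty_algEquiv_kOf_of_finrank_eq_one T.D hFm pp x y) (fun pp hpp i => ?_)
  · -- the local packages at a bad place `x | p`
    haveI : Fact (pp : ℕ).Prime := ⟨pp.2⟩
    have hE := heq pp x hx
    obtain ⟨hdvd, h2, hl, hv, hpole, hpos, hle, h15, h30, hodd, hq⟩ := hfacts pp x hx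
    obtain ⟨hne, -⟩ := hcell pp pp.2 hdvd h2 hl (eF pp) hpos hle h15 h30 hodd hq
    refine ⟨hE, ?_, ?_, ?_, ?_, ?_⟩
    · by_cases hw : (pp : ℕ) ∣ 30 ∧ ¬ (pp : ℕ) ∣ (a * b * c).factorization pp
      · rw [show DF pp = 2 * eF pp - 1 by simp only [hDF, if_pos hw]]
        have hd := GenuineK.sub_one_div_le_differentOrd_kOf_wild_ratPoint T pp hw.1 h2 hv hw.2 hpole x
        rw [hE] at hd
        exact hd
      · rw [show DF pp = eF pp - 1 by simp only [hDF, if_neg hw]]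
        exact Cor312Prov.pred_div_le_differentOrd_of_eq (pp : ℕ) hE
    · by_cases hw : 1 ≤ eF pp / ((pp : ℕ) - 1)
      · exact WRow.inner_witness_slot (pp : ℕ) h2 hE (show rinF pp = _ by simp only [hrinF, max_eq_right hw])
      · rw [show rinF pp = 1 by simp only [hrinF, max_eq_left (show eF pp / ((pp : ℕ) - 1) ≤ 1 by omega), Nat.cast_one]]
        exact WRow.inner_witness_trivial (pp : ℕ) _ (eF pp)
    · exact WRow.outer_member_min (pp : ℕ) hE hne (A pp) (B pp) rfl (by simp only [hroutF])
    · rw [show hF pp = 2 * (a * b * c).factorization pp by simp only [hhF],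
        hpole _ (natGenerator_finBelow_placeOf T.D pp x)]
      push_cast
      ring
    · rw [show hF pp = 2 * (a * b * c).factorization pp by simp only [hhF]]
      obtain ⟨k, hk⟩ := hle
      exact ⟨k * (a * b * c).factorization pp, by rw [hk]; ring⟩
  · -- the integer cells at every label `j = i + 1 ≤ (l − 1)/2`
    haveI : Fact (pp : ℕ).Prime := ⟨pp.2⟩
    obtain ⟨x, hx⟩ := hpp
    obtain ⟨hdvd, h2, hl, hv, hpole, hpos, hle, h15, h30, hodd, hq⟩ := hfacts pp x hx
    have hi : (i : ℕ) < (l - 1) / 2 := hlstar ▸ i.isLt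
    have hci := (hcell pp pp.2 hdvd h2 hl (eF pp) hpos hle h15 h30 hodd hq).2 i hi
    simp only [hDF, hhF, hrinF, hroutF]
    exact hci

/-- **BRANCH C's PER-DATUM ANTECEDENT «∃ ρ qK, QPinned ∧ PilotKummerCompatHull» at the `K`-level datum of ANY abc triple, with the local-type
hook `Q`** (any columns `col`; every pair of realising ideles, the CHOSEN ones of the window certificates included; hypotheses = `hQ` and the arithmetic
`hcell` of `WRow.licence_triple_slot_of_localType`) — via abc-iut-w5-d009's `exists_qPinned_and_hull_settingPrVolSharp_iff_licence`.
[cite: Mochizuki2012, IUTchIII Cor. 3.12 Step (xi-d) p. 183, (xi-f) p. 184] [cite: DupuyHilado2025, §3.3, §3.4, §4.9] [claim: Mochizuki2012, status: disputed] -/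
theorem WRow.exists_qPinned_and_hull_triple_slot_of_localType {a b c l : ℕ} (habc : IsABCTriple a b c)
    (hj1728 : Cor22.jInv ((a : ℚ) / c) ≠ 1728) (T : Cor22.ThetaVolumeDatumAt (ratPoint ((a : ℚ) / c)) l) (A B : ℕ → ℕ)
    (Q : ℕ → ℕ → Prop)
    (hQ : letI := T.instFieldF; letI := T.instNumberFieldF; letI := T.instAlgebraF; letI := T.instFieldK
      letI := T.instNumberFieldK; letI := T.instAlgebraK; letI := T.instFieldFbar; letI := T.instAlgebraFbar
      letI := T.instAlgebraKFbar; letI := T.instIsElliptic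
      ∀ (pp : Nat.Primes) (x : (thetaIndex (pilotDataOfK T.D T.K)).Fibre (.inr pp)),
        haveI : Fact (pp : ℕ).Prime := ⟨pp.2⟩
        placeOf (pilotDataOfK T.D T.K) pp.1 x ∈ (pilotDataOfK T.D T.K).S →
          Q pp (absRamificationIdx (pp : ℕ) (kOf (pilotDataOfK T.D T.K) pp.1 x)))
    (hcell : ∀ p : ℕ, p.Prime → p ∣ a * b * c → p ≠ 2 → p ≠ l → ∀ e : ℕ, 0 < e → l ∣ e →
      15 * l ∣ e * (a * b * c).factorization p → (p ∣ 30 → (p - 1) ∣ e) →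
      (p ∣ c → Odd ((a * b * c).factorization p) → 30 * l ∣ e * (a * b * c).factorization p) → Q p e →
      (∀ k : ℕ, (e : ℤ) ≠ (p : ℤ) ^ k * ((p : ℤ) - 1)) ∧
      ∀ i : ℕ, i < (l - 1) / 2 →
        (e : ℤ) * ((((i + 1 : ℕ) : ℤ) ^ 2 * ((e * (2 * (a * b * c).factorization p) / (2 * l) : ℕ) : ℤ) -
            ((i + 1 : ℕ) : ℤ) * (((if p ∣ 30 ∧ ¬ p ∣ (a * b * c).factorization p then 2 * e - 1 else e - 1 : ℕ) : ℕ) : ℤ) -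
            ((i + 2 : ℕ) : ℤ) * ((((max 1 (e / (p - 1))) : ℕ) : ℤ))) / (e : ℤ)) +
          ((i + 2 : ℕ) : ℤ) * min ((p : ℤ) ^ A p - (A p : ℤ) * (e : ℤ)) ((p : ℤ) ^ B p - (B p : ℤ) * (e : ℤ)) ≤
        ((e * (2 * (a * b * c).factorization p) / (2 * l) : ℕ) : ℤ))
    :
    letI := T.instFieldF; letI := T.instNumberFieldF; letI := T.instAlgebraF; letI := T.instFieldK
    letI := T.instNumberFieldK; letI := T.instAlgebraK; letI := T.instFieldFbar; letI := T.instAlgebraFbar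
    letI := T.instAlgebraKFbar; letI := T.instIsElliptic
    ∀ {logv : PadicLogs T.K} (hlog : LogvAnalytic logv) (M : Type) [Field M] [NumberField M]
      (archPk : ∀ (j : (thetaIndex (pilotDataOfK T.D T.K)).Label) (vQ : (thetaIndex (pilotDataOfK T.D T.K)).VQ),
        Set ((logShellsDH (pilotDataOfK T.D T.K) logv).Packet j vQ))
      (archSub : ∀ (j : (thetaIndex (pilotDataOfK T.D T.K)).Label) (v : (thetaIndex (pilotDataOfK T.D T.K)).V),
        Set ((logShellsDH (pilotDataOfK T.D T.K) logv).Packet j ((thetaIndex (pilotDataOfK T.D T.K)).over v)))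
      (Ψ : ℤ → ∀ v : (thetaIndex (pilotDataOfK T.D T.K)).V, v ∈ (thetaIndex (pilotDataOfK T.D T.K)).Vbad →
        Set ((logShellsDH (pilotDataOfK T.D T.K) logv).StarPacket v))
      (act : ℤ → ∀ v : (thetaIndex (pilotDataOfK T.D T.K)).V, v ∈ (thetaIndex (pilotDataOfK T.D T.K)).Vbad →
        (logShellsDH (pilotDataOfK T.D T.K) logv).StarPacket v → Module.End ℚ ((logShellsDH (pilotDataOfK T.D T.K) logv).StarPacket v))
      (Mmod : ℤ → ∀ j : (thetaIndex (pilotDataOfK T.D T.K)).LabelStar, Set ((logShellsDH (pilotDataOfK T.D T.K) logv).GlobalPacket j.1))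
      (region : ℤ → ∀ j : (thetaIndex (pilotDataOfK T.D T.K)).LabelStar, FinDivisor M → ∀ vQ : (thetaIndex (pilotDataOfK T.D T.K)).VQ,
        Set ((logShellsDH (pilotDataOfK T.D T.K) logv).Packet j.1 vQ))
      (n : ℤ) {HT : Type} {LogLink : HT → HT → Type} {IsFull : ∀ {s t : HT}, LogLink s t → Prop}
      (lat : LGPGaussianLogThetaLattice LogLink IsFull)
      {Frd : Type} {IsoF : Frd → Frd → Type} {Ob : Frd → Type} {realify : Frd → Frd} {Strip : Type}
      {IsoS : Strip → Strip → Type} {Mv : ∀ v : (thetaIndex (pilotDataOfK T.D T.K)).V, v ∈ (thetaIndex (pilotDataOfK T.D T.K)).Vbad → Type}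
      [∀ v h, Monoid (Mv v h)]
      (sig : GlobalLGPFrobenioidSignature (thetaIndex (pilotDataOfK T.D T.K)).lstar (thetaIndex (pilotDataOfK T.D T.K)).V
        (· ∈ (thetaIndex (pilotDataOfK T.D T.K)).Vbad) Frd IsoF Ob realify Strip IsoS Mv)
      (split : SplittingMonoids Mv) {ObΔ : Type} {N : ∀ v : (thetaIndex (pilotDataOfK T.D T.K)).V, v ∈ (thetaIndex (pilotDataOfK T.D T.K)).Vbad → Type}
      [∀ v h, Monoid (N v h)] (qData : QPilotData ObΔ N)
      (tq : ∀ (pp : Nat.Primes) (x : (thetaIndex (pilotDataOfK T.D T.K)).Fibre (.inr pp)),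
        haveI : Fact (pp : ℕ).Prime := ⟨pp.2⟩; kOf (pilotDataOfK T.D T.K) pp.1 x)
      (t : ∀ (pp : Nat.Primes) (_ : Fin (pilotDataOfK T.D T.K).lstar) (x : (thetaIndex (pilotDataOfK T.D T.K)).Fibre (.inr pp)),
        haveI : Fact (pp : ℕ).Prime := ⟨pp.2⟩; kOf (pilotDataOfK T.D T.K) pp.1 x)
      (htq0 : ∀ pp x, tq pp x ≠ 0)
      (htq1 : ∀ (pp : Nat.Primes) (x : (thetaIndex (pilotDataOfK T.D T.K)).Fibre (.inr pp)),
        haveI : Fact (pp : ℕ).Prime := ⟨pp.2⟩; placeOf (pilotDataOfK T.D T.K) pp.1 x ∉ (pilotDataOfK T.D T.K).S → ‖tq pp x‖ = 1)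
      (col : ℤ → Column (logShellsDH (pilotDataOfK T.D T.K) logv))
      (_ht0 : ∀ pp i x, t pp i x ≠ 0)
      (_ht : ∀ (pp : Nat.Primes) (i : Fin (pilotDataOfK T.D T.K).lstar) (x : (thetaIndex (pilotDataOfK T.D T.K)).Fibre (.inr pp)),
        haveI : Fact (pp : ℕ).Prime := ⟨pp.2⟩
        Real.log ‖t pp i x‖ = -((pilotDataOfK T.D T.K).thetaPilot i (placeOf (pilotDataOfK T.D T.K) pp.1 x)) *
          logNorm T.K (placeOf (pilotDataOfK T.D T.K) pp.1 x) / localDegree T.K (placeOf (pilotDataOfK T.D T.K) pp.1 x))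
      (_htq : ∀ (pp : Nat.Primes) (x : (thetaIndex (pilotDataOfK T.D T.K)).Fibre (.inr pp)),
        haveI : Fact (pp : ℕ).Prime := ⟨pp.2⟩
        Real.log ‖tq pp x‖ = -((pilotDataOfK T.D T.K).qPilot (placeOf (pilotDataOfK T.D T.K) pp.1 x)) *
          logNorm T.K (placeOf (pilotDataOfK T.D T.K) pp.1 x) / localDegree T.K (placeOf (pilotDataOfK T.D T.K) pp.1 x)),
      ∃ (ρ : (∀ v : (thetaIndex (pilotDataOfK T.D T.K)).V, v ∈ (thetaIndex (pilotDataOfK T.D T.K)).Vbad →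
              Set ((logShellsDH (pilotDataOfK T.D T.K) logv).StarPacket v)) →
            ∀ (j : (thetaIndex (pilotDataOfK T.D T.K)).Label) (vQ : (thetaIndex (pilotDataOfK T.D T.K)).VQ),
              Set ((logShellsDH (pilotDataOfK T.D T.K) logv).Packet j vQ))
          (qK : ∀ v : (thetaIndex (pilotDataOfK T.D T.K)).V, v ∈ (thetaIndex (pilotDataOfK T.D T.K)).Vbad →
            Set ((logShellsDH (pilotDataOfK T.D T.K) logv).StarPacket v)),
          QPinned ({ toSituation := situationPrVol (pilotDataOfK T.D T.K) hlog M archPk archSub Ψ act Mmod region, col := col } :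
              LatticeSituation (thetaIndex (pilotDataOfK T.D T.K)))
            (settingPrVolSharp (pilotDataOfK T.D T.K) hlog M archPk archSub Ψ act Mmod region n lat sig split qData tq t htq0 htq1) ρ qK ∧
          PilotKummerCompatHull ({ toSituation := situationPrVol (pilotDataOfK T.D T.K) hlog M archPk archSub Ψ act Mmod region, col := col } :
              LatticeSituation (thetaIndex (pilotDataOfK T.D T.K)))
            (settingPrVolSharp (pilotDataOfK T.D T.K) hlog M archPk archSub Ψ act Mmod region n lat sig split qData tq t htq0 htq1) ρ qK := by
  letI := T.instFieldF; letI := T.instNumberFieldF; letI := T.instAlgebraF; letI := T.instFieldK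
  letI := T.instNumberFieldK; letI := T.instAlgebraK; letI := T.instFieldFbar; letI := T.instAlgebraFbar
  letI := T.instAlgebraKFbar; letI := T.instIsElliptic
  intro logv hlog M _ _ archPk archSub Ψ act Mmod region n HT LogLink IsFull lat Frd IsoF Ob realify Strip
    IsoS Mv _ sig split ObΔ N _ qData tq t htq0 htq1 col ht0 ht htq
  exact (exists_qPinned_and_hull_settingPrVolSharp_iff_licence (pilotDataOfK T.D T.K) hlog M archPk archSub Ψ act Mmod region n lat sig
    split qData tq t htq0 htq1 col (fun pp x => norm_qIdele_le_one_of_realises (pilotDataOfK T.D T.K) tq htq0 htq pp x)).2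
    (WRow.licence_triple_slot_of_localType habc hj1728 T A B Q hQ hcell hlog M archPk archSub Ψ act Mmod region n lat sig split qData tq t htq0 htq1
      ht0 ht htq)

end Summit.ABC.IUTFork.Conditional

end
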